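import Summits.KontsevichZagierPeriods.KontsevichZagierPeriods.Theses.LiouvilleUnfolding
import Literature.NumberTheory.Transcendental.KZLogCalculusProofs
import Literature.NumberTheory.Transcendental.KZIntervalPeriodProofs
import Literature.NumberTheory.Transcendental.SemialgebraicDerivativeProofs

/-!
# `LiouvilleUnfolding.UnfoldedLogStokes` (stmt-KontsevichZagierPeriods-2835) — redundant hypotheses

Hypothesis mutation of the crux `UnfoldedLogStokes` (refuter, cdisprove; companion of
`Negative/LoadBearing.lean`, `LoadBearingII.lean`, `Strengthenings.lean`).  The crux carries FIVE
semialgebraicity hypotheses (`τ`, `a`, `b` on the base; `H`, `V` on the band).  FOUR of them are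
DERIVABLE from the honesty of the representations `r₄`, `r₁` (their domains are `ℚ`-semialgebraic — a
field of `KZ.IntegralRep`) together with `a ≤ b`, the band equation for `r₄.domain`, the unfolded-band
equation for `r₁.domain` and `1 ≤ V`:
* `b` (resp. `a`) is the upper (resp. lower) EDGE FUNCTION of the semialgebraic band `r₄.domain`, whose
  fibres are non-empty — semialgebraic by one Tarski–Seidenberg projection and a complement
  (`isSemialgebraicFunOn_upper_of_band`, `isSemialgebraicFunOn_lower_of_band`);
* `τ` is the projection of the graph of `b` (`isSemialgebraic_of_funOn`);
* `V` is the upper edge function of the semialgebraic band `r₁.domain = {1 ≤ u ≤ V}` over `r₄.domain`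
  (fibres non-empty exactly because `1 ≤ V`).
Hence the variant `WithoutSaData` with all four clauses deleted is EQUIVALENT to the crux
(`withoutSaData_iff`; no positive claim about the crux is made here).  Information for the planner (the
statement can be slimmed by four clauses verbatim) and for refuters (no mutation of these four can
bite).  The fifth hypothesis, `H` semialgebraic, is NOT derivable (`H` is invisible to the representations
off `{V' ≠ 0}`); see `Negative/InvisibleH.lean`.
[Bochnak–Coste–Roy 1998, Thm. 2.2.1, §2.2] [folklore]
-/

noncomputable section

open Set MeasureTheory MvPolynomial Filter Topology
open Literature.NumberTheory.Transcendental Literature.ModelTheory.ExponentialFields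
open Literature.NumberTheory.Transcendental.SemialgebraicDerivative (sa_lt)
open Summit.KontsevichZagierPeriods.KontsevichZagierPeriods.Theses.LiouvilleUnfolding (UnfoldedLogStokes)

namespace Summit.KontsevichZagierPeriods.LiouvilleUnfolding.UnfoldedLogStokesNegative

section Redundant

variable {m : ℕ}

/-- The base of a `ℚ`-semialgebraic function is `ℚ`-semialgebraic (projection of the graph,
Tarski–Seidenberg `tarski_seidenberg_real_holds`). [folklore] -/
theorem isSemialgebraic_of_funOn {s : Set (Fin m → ℝ)} {f : (Fin m → ℝ) → ℝ}
    (hf : IsSemialgebraicFunOn ℚ s f) : IsSemialgebraic ℚ s := by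
  have h := tarski_seidenberg_real_holds (k := ℚ) (isSemialgebraicFunOn_iff.mp hf)
  convert h using 1
  ext x
  simp only [mem_image, mem_setOf_eq]
  constructor
  · intro hx
    refine ⟨Fin.snoc x (f x), ⟨by simpa using hx, by simp⟩, ?_⟩
    funext i
    simp
  · rintro ⟨z, ⟨hz, -⟩, rfl⟩
    exact hz

/-- Coordinate embedding reading `(x, s)` off `w = (x, t, s) ∈ ℝᵐ⁺²`: `w ∘ σup m = (init (init w), w last)`.
[folklore] -/
def σup (m : ℕ) : Fin (m + 1) → Fin (m + 2) :=
  Fin.snoc (fun i : Fin m => Fin.castSucc (Fin.castSucc i)) (Fin.last (m + 1))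

/-- `w ∘ σup m` is `(init (init w), w last)`. [folklore] -/
theorem comp_σup (w : Fin (m + 2) → ℝ) :
    (w ∘ σup m) = Fin.snoc (Fin.init (Fin.init w)) (w (Fin.last (m + 1))) := by
  funext j
  induction j using Fin.lastCases with
  | last => simp [σup]
  | cast i => simp [σup, Fin.init]

/-- The points of `ℝᵐ⁺¹` lying strictly BELOW some point of `B` on the same vertical line form a
`ℚ`-semialgebraic set: the Tarski–Seidenberg projection (along the new last coordinate `s`) of
`{(z, s) | (init z, s) ∈ B ∧ z last < s}`. [BCR 1998, Thm. 2.2.1] [folklore] -/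
theorem isSemialgebraic_setOf_exists_above {B : Set (Fin (m + 1) → ℝ)} (hB : IsSemialgebraic ℚ B) :
    IsSemialgebraic ℚ {z : Fin (m + 1) → ℝ | ∃ s : ℝ,
      (Fin.snoc (Fin.init z) s : Fin (m + 1) → ℝ) ∈ B ∧ z (Fin.last m) < s} := by
  have hT := (hB.preimage_comp (σup m)).inter
    (sa_lt (k := ℚ) (Fin.castSucc (Fin.last m)) (Fin.last (m + 1)))
  convert tarski_seidenberg_real_holds (k := ℚ) hT using 1
  ext z
  simp only [mem_setOf_eq, mem_image, mem_inter_iff, mem_preimage]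
  constructor
  · rintro ⟨s, hs, hlt⟩
    refine ⟨Fin.snoc z s, ⟨?_, ?_⟩, ?_⟩
    · rw [comp_σup]
      simpa using hs
    · simpa using hlt
    · funext i
      simp
  · rintro ⟨w, ⟨hwB, hwlt⟩, rfl⟩
    refine ⟨w (Fin.last (m + 1)), ?_, ?_⟩
    · rw [comp_σup] at hwB
      exact hwB
    · exact hwlt

/-- Same, strictly ABOVE: `{z | ∃ s, (init z, s) ∈ B ∧ s < z last}` is `ℚ`-semialgebraic. [folklore] -/
theorem isSemialgebraic_setOf_exists_below {B : Set (Fin (m + 1) → ℝ)} (hB : IsSemialgebraic ℚ B) :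
    IsSemialgebraic ℚ {z : Fin (m + 1) → ℝ | ∃ s : ℝ,
      (Fin.snoc (Fin.init z) s : Fin (m + 1) → ℝ) ∈ B ∧ s < z (Fin.last m)} := by
  have hT := (hB.preimage_comp (σup m)).inter
    (sa_lt (k := ℚ) (Fin.last (m + 1)) (Fin.castSucc (Fin.last m)))
  convert tarski_seidenberg_real_holds (k := ℚ) hT using 1
  ext z
  simp only [mem_setOf_eq, mem_image, mem_inter_iff, mem_preimage]
  constructor
  · rintro ⟨s, hs, hlt⟩
    refine ⟨Fin.snoc z s, ⟨?_, ?_⟩, ?_⟩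
    · rw [comp_σup]
      simpa using hs
    · simpa using hlt
    · funext i
      simp
  · rintro ⟨w, ⟨hwB, hwlt⟩, rfl⟩
    refine ⟨w (Fin.last (m + 1)), ?_, ?_⟩
    · rw [comp_σup] at hwB
      exact hwB
    · exact hwlt

/-- **The upper edge of a semialgebraic band with non-empty fibres is a semialgebraic function**: if
`{(x,t) | x ∈ S, lo x ≤ t ≤ hi x}` is `ℚ`-semialgebraic and `lo ≤ hi` on `S`, then `hi` is
`ℚ`-semialgebraic on `S` — its graph is the band minus the points strictly below another band point.
[BCR 1998, §2.2] [folklore] -/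
theorem isSemialgebraicFunOn_upper_of_band {S : Set (Fin m → ℝ)} {lo hi : (Fin m → ℝ) → ℝ}
    (hB : IsSemialgebraic ℚ (KZlog.band S lo hi)) (hle : ∀ x ∈ S, lo x ≤ hi x) :
    IsSemialgebraicFunOn ℚ S hi := by
  rw [isSemialgebraicFunOn_iff]
  convert hB.diff (isSemialgebraic_setOf_exists_above hB) using 1
  ext z
  constructor
  · rintro ⟨hz, heq⟩
    refine ⟨⟨hz, by rw [heq]; exact hle _ hz, heq.le⟩, ?_⟩
    rintro ⟨s, hs, hlt⟩
    rw [KZlog.snoc_mem_band] at hs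
    rw [heq] at hlt
    exact (not_lt.2 hs.2.2) hlt
  · rintro ⟨⟨hz, -, hhi⟩, hno⟩
    refine ⟨hz, le_antisymm hhi (not_lt.1 fun hlt => hno ⟨hi (Fin.init z), ?_, hlt⟩)⟩
    exact KZlog.snoc_mem_band.2 ⟨hz, hle _ hz, le_rfl⟩

/-- **The lower edge of a semialgebraic band with non-empty fibres is a semialgebraic function.**
[BCR 1998, §2.2] [folklore] -/
theorem isSemialgebraicFunOn_lower_of_band {S : Set (Fin m → ℝ)} {lo hi : (Fin m → ℝ) → ℝ}
    (hB : IsSemialgebraic ℚ (KZlog.band S lo hi)) (hle : ∀ x ∈ S, lo x ≤ hi x) :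
    IsSemialgebraicFunOn ℚ S lo := by
  rw [isSemialgebraicFunOn_iff]
  convert hB.diff (isSemialgebraic_setOf_exists_below hB) using 1
  ext z
  constructor
  · rintro ⟨hz, heq⟩
    refine ⟨⟨hz, heq.ge, by rw [heq]; exact hle _ hz⟩, ?_⟩
    rintro ⟨s, hs, hlt⟩
    rw [KZlog.snoc_mem_band] at hs
    rw [heq] at hlt
    exact (not_lt.2 hs.2.1) hlt
  · rintro ⟨⟨hz, hlo, -⟩, hno⟩
    refine ⟨hz, le_antisymm (not_lt.1 fun hlt => hno ⟨lo (Fin.init z), ?_, hlt⟩) hlo⟩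
    exact KZlog.snoc_mem_band.2 ⟨hz, le_rfl, hle _ hz⟩

/-- The base of a semialgebraic band with non-empty fibres is semialgebraic. [folklore] -/
theorem isSemialgebraic_base_of_band {S : Set (Fin m → ℝ)} {lo hi : (Fin m → ℝ) → ℝ}
    (hB : IsSemialgebraic ℚ (KZlog.band S lo hi)) (hle : ∀ x ∈ S, lo x ≤ hi x) :
    IsSemialgebraic ℚ S :=
  isSemialgebraic_of_funOn (isSemialgebraicFunOn_upper_of_band hB hle)

/-- The crux `LiouvilleUnfolding.UnfoldedLogStokes` with the FOUR semialgebraicity hypotheses on `τ`, `a`,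
`b` (base data) and on `V` DELETED (all other clauses verbatim from the Theses decl, cf.
`UnfoldedLogStokesNegative.Orig` in `Negative/Kit.lean`). -/
def WithoutSaData : Prop :=
  ∀ (n : ℕ) (τ : Set (Fin n → ℝ)) (a b : (Fin n → ℝ) → ℝ) (H H' V V' : (Fin (n + 1) → ℝ) → ℝ) (r₁ : Literature.NumberTheory.Transcendental.KZ.IntegralRep (n + 2)) (r₂ r₃ r₄ : Literature.NumberTheory.Transcendental.KZ.IntegralRep (n + 1)),
    (∀ x ∈ τ, a x ≤ b x) →
    r₄.domain = {z | (Fin.init z : Fin n → ℝ) ∈ τ ∧ a (Fin.init z) ≤ z (Fin.last n) ∧ z (Fin.last n) ≤ b (Fin.init z)} →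
    Literature.NumberTheory.Transcendental.IsSemialgebraicFunOn ℚ r₄.domain H →
    (∀ z ∈ r₄.domain, 1 ≤ V z) →
    (∀ x ∈ τ, ContinuousOn (fun t : ℝ => H (Fin.snoc x t)) (Set.Icc (a x) (b x)) ∧ ContinuousOn (fun t : ℝ => V (Fin.snoc x t)) (Set.Icc (a x) (b x))) →
    (∀ x ∈ τ, ∀ t ∈ Set.Ioo (a x) (b x), HasDerivAt (fun s : ℝ => H (Fin.snoc x s)) (H' (Fin.snoc x t)) t ∧ HasDerivAt (fun s : ℝ => V (Fin.snoc x s)) (V' (Fin.snoc x t)) t) →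
    (∀ z ∈ r₄.domain, a (Fin.init z) < z (Fin.last n) → z (Fin.last n) < b (Fin.init z) → r₄.integrand z = H z * V' z / V z) →
    r₁.domain = {w | (Fin.init w : Fin (n + 1) → ℝ) ∈ r₄.domain ∧ 1 ≤ w (Fin.last (n + 1)) ∧ w (Fin.last (n + 1)) ≤ V (Fin.init w)} →
    (∀ w ∈ r₁.domain, a (Fin.init (Fin.init w)) < Fin.init w (Fin.last n) → Fin.init w (Fin.last n) < b (Fin.init (Fin.init w)) → r₁.integrand w = H' (Fin.init w) / w (Fin.last (n + 1))) →
    r₂.domain = {z | (Fin.init z : Fin n → ℝ) ∈ τ ∧ 1 ≤ z (Fin.last n) ∧ z (Fin.last n) ≤ V (Fin.snoc (Fin.init z) (b (Fin.init z)))} →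
    (∀ z ∈ r₂.domain, r₂.integrand z = H (Fin.snoc (Fin.init z) (b (Fin.init z))) / z (Fin.last n)) →
    r₃.domain = {z | (Fin.init z : Fin n → ℝ) ∈ τ ∧ 1 ≤ z (Fin.last n) ∧ z (Fin.last n) ≤ V (Fin.snoc (Fin.init z) (a (Fin.init z)))} →
    (∀ z ∈ r₃.domain, r₃.integrand z = H (Fin.snoc (Fin.init z) (a (Fin.init z))) / z (Fin.last n)) →
    Literature.NumberTheory.Transcendental.KZ.of r₁ - Literature.NumberTheory.Transcendental.KZ.of r₂ + Literature.NumberTheory.Transcendental.KZ.of r₃ + Literature.NumberTheory.Transcendental.KZ.of r₄ ∈ Literature.NumberTheory.Transcendental.KZ.relations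

/-- **Four semialgebraicity hypotheses are decoration**: `τ`, `a`, `b` semialgebraic and `V`
semialgebraic on the band are DERIVABLE from the honesty of `r₄`, `r₁` (semialgebraic domains) plus
`hab`, `hr₄d`, `hr₁d`, `hV1`; so the slimmed statement is equivalent to the crux. -/
theorem withoutSaData_iff : WithoutSaData ↔ UnfoldedLogStokes := by
  constructor
  · intro h n τ a b H H' V V' r₁ r₂ r₃ r₄ _ _ _ hab hr₄d hH _ hV1
    exact h n τ a b H H' V V' r₁ r₂ r₃ r₄ hab hr₄d hH hV1
  · intro h n τ a b H H' V V' r₁ r₂ r₃ r₄ hab hr₄d hH hV1 hcont hder hr₄i hr₁d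
    have hB : IsSemialgebraic ℚ (KZlog.band τ a b) := by
      have h4 := r₄.isSemialgebraic_domain
      rwa [hr₄d] at h4
    have hb : IsSemialgebraicFunOn ℚ τ b := isSemialgebraicFunOn_upper_of_band hB hab
    have ha : IsSemialgebraicFunOn ℚ τ a := isSemialgebraicFunOn_lower_of_band hB hab
    have hτ : IsSemialgebraic ℚ τ := isSemialgebraic_of_funOn hb
    have hV : IsSemialgebraicFunOn ℚ r₄.domain V := by
      have h1 := r₁.isSemialgebraic_domain
      rw [hr₁d] at h1
      exact isSemialgebraicFunOn_upper_of_band (S := r₄.domain) (lo := fun _ => (1 : ℝ)) (hi := V)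
        h1 hV1
    exact h n τ a b H H' V V' r₁ r₂ r₃ r₄ hτ ha hb hab hr₄d hH hV hV1 hcont hder hr₄i hr₁d

end Redundant

end Summit.KontsevichZagierPeriods.LiouvilleUnfolding.UnfoldedLogStokesNegative
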